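import Mathlib
import HarnessLib

/-!
# Route NewtonUnitEquations — crux `TwoProducts` (stmt-ValiantsHypothesis-5906), line `formal-log-linearisation`:
# the lifted pencil count is `≤ 2m` — uniformly in `m` AND `s` — on every coordinate-split pencil plane

Registered line `Cruxes/TwoProducts/Lines/formal-log-linearisation.lean` (NOT the item's skeleton of record; helper
mode `--supports stmt-ValiantsHypothesis-5906 --as helper`, no stub credit claimed).  Theory lane on the OPEN engine
`stub_logSumEngine`, in the currency of the memo's `LiftedPencilCount` (`memo-logSumEngine-core.md`; necessity:
`…LiftedNecessityReal.liftedPencilCount_of_twoProducts`; `m = 2`: `…LiftedPairLinear.liftedPencilCount_two_linear`;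
`s = 2`: `…LiftedTwoMonomials.liftedPencilCount_twoMonomials`).

**The Hankel-rank / crossover argument.**  For two `m`-point configurations `A, B ⊂ ℂ^s` the unequal-moment function
`G(ν) = Σ_j A_j^ν − Σ_j B_j^ν` is a signed sum of `2m` multiplicative characters of `ℕ^s`, so for every splitting of
the coordinates into two groups `I ⊔ J` the matrix `(G(α + β))_{α ∈ ℕ^I, β ∈ ℕ^J}` has rank `≤ 2m`.  If the pencil is
generated by two nonnegative gradings with DISJOINT supports — `u` living on `I`, `v` on `J`, weights
`X(ν) = u·ν`, `Y(ν) = v·ν`, pencil `X + cY` — then a pencil-visible point `μ'` (strict `(X + c'Y)`-minimiser of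
`{G ≠ 0}`) kills every CROSSOVER `(μ_I, μ'_J)` with `X(μ) < X(μ')`: it has weight `X(μ) + c'Y(μ') < X(μ') + c'Y(μ')`.
Since `X` is injective on the visible set (equal `X` and comparable `Y` contradict strictness), sorting the visible
points by `X` makes the crossover matrix `(G(μ^a_I, μ^b_J))_{a,b}` triangular with nonzero diagonal `G(μ^a) ≠ 0`, and
the rank obstruction (Disproof F4, `Theorems/TwoProducts/Negative/RankObstruction.lean: card_corners_le_rank`; restated
here for `Fin`-indexed factorisations as `card_le_of_triangular_factor`, so that this file does not sit on the route
cone of that module) gives **`#visible ≤ 2m`**.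

* `card_le_of_triangular_factor` — a `t × t` matrix factoring through `Fin r`, triangular with nonzero diagonal, has
  `t ≤ r`;
* `pencilWeight_split` — `Σ (u_i + c v_i) ν_i = X(ν) + c·Y(ν)`;
* `crossover_X`, `crossover_Y`, `crossover_self` — the crossover bookkeeping;
* `unequalMoment_crossover_eq` — `G` at a crossover factors through `Fin (m + m)` (characters are multiplicative);
* `liftedPencilCount_separatedPencil` — **for nonnegative `u, v : Fin s → ℝ` with `u_i = 0 ∨ v_i = 0` for every `i`,
  every finite set of `(u + cv)`-pencil-visible unequal moments has at most `2m` elements** (any `s`, any `m`);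
* `liftedPencilCount_splitPlane` — the same bound in the memo's verbatim shape (strictly positive `θ₁, θ₂`) whenever
  `θ₁ = αu + βv`, `θ₂ = γu + δv` with `α, β, γ, δ > 0` for such a disjointly supported pair `(u, v)` — e.g. every
  pencil on two monomials (`s = 2`), and the "radix" pencils `θ = (N^0,…,N^{k-1} | λN^0,…,λN^{l-1})` under which the box
  `{0,…,N-1}^s` projects INJECTIVELY onto a planar grid (the pencils that make the shadow largest are harmless).

So a counterexample to the `m`-uniform count must use pencil planes that are not coordinate-split; equivalently the
difficulty is entirely in how the two orders `X`, `Y` interleave the coordinates.  Honest framing: an elementary rank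
count for the THEORY lane of an OPEN engine; `stub_logSumEngine`, the crux `TwoProducts` and the `m`-uniformity of
`LiftedPencilCount` stay OPEN, the line is not the item's skeleton of record, and nothing here is progress on `VP ≠ VNP`
(NOT proved).  No definitions, no named facts. [folklore]
-/

noncomputable section

-- Sub = Summit single-conjunct layout: the duplicated namespace component is mandated by the tree.
set_option linter.dupNamespace false

namespace Summit.ValiantsHypothesis.ValiantsHypothesis.Theorems.NewtonUnitEquations.TwoProducts.FormalLogLinearisation

open scoped BigOperators

/-- **Rank obstruction, `Fin`-indexed form** (cf. `TwoProducts.Negative.card_corners_le_rank`, Disproof F4): if the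
`t × t` matrix `P * Q` factors through `Fin r` and is lower triangular (`(P*Q)_{ab} = 0` for `a < b`) with nonzero
diagonal, then `t ≤ r` — it is invertible of rank `t`, and its rank is at most the inner dimension. [folklore] -/
theorem card_le_of_triangular_factor {K : Type*} [Field K] {t r : ℕ} (P : Matrix (Fin t) (Fin r) K)
    (Q : Matrix (Fin r) (Fin t) K) (hdiag : ∀ a, (P * Q) a a ≠ 0)
    (hupper : ∀ a b, a < b → (P * Q) a b = 0) : t ≤ r := by
  classical
  set M : Matrix (Fin t) (Fin t) K := P * Q with hM
  have htri : M.BlockTriangular OrderDual.toDual := fun a b hab => hupper a b (by simpa using hab)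
  have hdet : M.det ≠ 0 := by
    rw [Matrix.det_of_lowerTriangular M htri]
    exact Finset.prod_ne_zero_iff.2 (fun a _ => hdiag a)
  have hunit : IsUnit M := (Matrix.isUnit_iff_isUnit_det M).2 (isUnit_iff_ne_zero.2 hdet)
  have h1 : M.rank = t := by rw [Matrix.rank_of_isUnit M hunit, Fintype.card_fin]
  have h2 : M.rank ≤ r := by
    rw [hM]
    exact (Matrix.rank_mul_le_left P Q).trans (by simpa using Matrix.rank_le_card_width P)
  omega

/-- Splitting a pencil weight: `Σ_i (u_i + c·v_i)·ν_i = (Σ_i u_i ν_i) + c·(Σ_i v_i ν_i)`. [folklore] -/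
theorem pencilWeight_split {s : ℕ} (u v : Fin s → ℝ) (c : ℝ) (ν : Fin s → ℕ) :
    ∑ i, (u i + c * v i) * (ν i : ℝ) = (∑ i, u i * (ν i : ℝ)) + c * ∑ i, v i * (ν i : ℝ) := by
  simp only [add_mul, Finset.sum_add_distrib, Finset.mul_sum, mul_assoc]

/-- The `X`-weight of the crossover `(μ on {v = 0}, μ' elsewhere)` is the `X`-weight of `μ` when `u` vanishes
wherever `v` does not. [folklore] -/
theorem crossover_X {s : ℕ} (u v : Fin s → ℝ) (hsep : ∀ i, u i = 0 ∨ v i = 0) (μ μ' : Fin s → ℕ) :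
    ∑ i, u i * ((fun i => if v i = 0 then μ i else μ' i) i : ℝ) = ∑ i, u i * (μ i : ℝ) := by
  refine Finset.sum_congr rfl fun i _ => ?_
  by_cases h : v i = 0
  · simp [h]
  · have hu : u i = 0 := (hsep i).resolve_right h
    simp [h, hu]

/-- The `Y`-weight of the crossover `(μ on {v = 0}, μ' elsewhere)` is the `Y`-weight of `μ'`. [folklore] -/
theorem crossover_Y {s : ℕ} (v : Fin s → ℝ) (μ μ' : Fin s → ℕ) :
    ∑ i, v i * ((fun i => if v i = 0 then μ i else μ' i) i : ℝ) = ∑ i, v i * (μ' i : ℝ) := by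
  refine Finset.sum_congr rfl fun i _ => ?_
  by_cases h : v i = 0
  · simp [h]
  · simp [h]

/-- The crossover of a point with itself is the point. [folklore] -/
theorem crossover_self {s : ℕ} (v : Fin s → ℝ) (μ : Fin s → ℕ) :
    (fun i => if v i = 0 then μ i else μ i) = μ := by
  funext i; split_ifs <;> rfl

/-- **Characters are multiplicative: `G` at a crossover factors through `Fin (m + m)`.**  With
`a_j(μ) = ∏_{v_i = 0} A_{ji}^{μ_i}` (resp. `-∏_{v_i = 0} B_{ji}^{μ_i}`) and `b_j(μ') = ∏_{v_i ≠ 0} A_{ji}^{μ'_i}` (resp.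
`B`), `Σ_{j < m+m} a_j(μ) b_j(μ') = Σ_j A_j^{cross} − Σ_j B_j^{cross}` for the crossover
`cross = (μ on {v = 0}, μ' elsewhere)`. [folklore] -/
theorem unequalMoment_crossover_eq {m s : ℕ} (A B : Fin m → Fin s → ℂ) (v : Fin s → ℝ) (μ μ' : Fin s → ℕ) :
    ∑ j : Fin (m + m),
        Fin.addCases (motive := fun _ => ℂ)
          (fun j => ∏ i, (if v i = 0 then A j i ^ μ i else 1))
          (fun j => -∏ i, (if v i = 0 then B j i ^ μ i else 1)) j *
        Fin.addCases (motive := fun _ => ℂ)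
          (fun j => ∏ i, (if v i = 0 then (1 : ℂ) else A j i ^ μ' i))
          (fun j => ∏ i, (if v i = 0 then (1 : ℂ) else B j i ^ μ' i)) j =
      (∑ j, ∏ i, A j i ^ (fun i => if v i = 0 then μ i else μ' i) i) -
        ∑ j, ∏ i, B j i ^ (fun i => if v i = 0 then μ i else μ' i) i := by
  rw [Fin.sum_univ_add]
  simp only [Fin.addCases_left, Fin.addCases_right, neg_mul, Finset.sum_neg_distrib, ← sub_eq_add_neg]
  have key : ∀ (C : Fin m → Fin s → ℂ) (j : Fin m),
      (∏ i, (if v i = 0 then C j i ^ μ i else 1)) * ∏ i, (if v i = 0 then (1 : ℂ) else C j i ^ μ' i) =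
        ∏ i, C j i ^ (fun i => if v i = 0 then μ i else μ' i) i := by
    intro C j
    rw [← Finset.prod_mul_distrib]
    refine Finset.prod_congr rfl fun i _ => ?_
    by_cases h : v i = 0 <;> simp [h]
  simp only [key]

/-- **Lifted pencil count on a separated pencil: `≤ 2m`, uniformly in `m` and `s`.**  Let `A, B : Fin m → Fin s → ℂ`
and let `u, v : Fin s → ℝ` be nonnegative gradings with disjoint supports (`u_i = 0 ∨ v_i = 0`).  Every finite set `S`
of multi-indices `μ` with unequal moments `Σ_j A_j^μ ≠ Σ_j B_j^μ`, each the STRICT minimiser of `{unequal}` for some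
member `u + c·v` (`c > 0`) of the pencil, has `#S ≤ 2m`.  Proof: `X = u·(-)` is injective on `S`; sorted by `X`, the
crossover matrix `(G(μ^a on {v=0}, μ^b elsewhere))_{a,b}` is lower triangular (a crossover with `a < b` is strictly
lighter than `μ^b` for `μ^b`'s grading, so `G` vanishes there) with diagonal `G(μ^a) ≠ 0`, and it factors through
`Fin (m+m)` (`unequalMoment_crossover_eq`); conclude by `card_le_of_triangular_factor`. [folklore] -/
theorem liftedPencilCount_separatedPencil {m s : ℕ} (A B : Fin m → Fin s → ℂ) (u v : Fin s → ℝ)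
    (hsep : ∀ i, u i = 0 ∨ v i = 0) (S : Finset (Fin s → ℕ))
    (hS : ∀ μ ∈ S, (∑ j, ∏ i, A j i ^ μ i) ≠ (∑ j, ∏ i, B j i ^ μ i) ∧
      ∃ c : ℝ, 0 < c ∧ ∀ ν : Fin s → ℕ, ν ≠ μ →
        (∑ j, ∏ i, A j i ^ ν i) ≠ (∑ j, ∏ i, B j i ^ ν i) →
          ∑ i, (u i + c * v i) * (μ i : ℝ) < ∑ i, (u i + c * v i) * (ν i : ℝ)) :
    S.card ≤ 2 * m := by
  classical
  -- the two weights
  set X : (Fin s → ℕ) → ℝ := fun ν => ∑ i, u i * (ν i : ℝ) with hX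
  set Y : (Fin s → ℕ) → ℝ := fun ν => ∑ i, v i * (ν i : ℝ) with hY
  -- the unequal-moment predicate
  set Gc : (Fin s → ℕ) → ℂ := fun ν => (∑ j, ∏ i, A j i ^ ν i) - ∑ j, ∏ i, B j i ^ ν i with hGc
  have hGc_ne : ∀ ν, Gc ν ≠ 0 ↔ (∑ j, ∏ i, A j i ^ ν i) ≠ (∑ j, ∏ i, B j i ^ ν i) := fun ν => by
    simp only [hGc, ne_eq, sub_eq_zero]
  -- crossover
  let cross : (Fin s → ℕ) → (Fin s → ℕ) → (Fin s → ℕ) := fun μ μ' i => if v i = 0 then μ i else μ' i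
  have hcrossX : ∀ μ μ', X (cross μ μ') = X μ := fun μ μ' => crossover_X u v hsep μ μ'
  have hcrossY : ∀ μ μ', Y (cross μ μ') = Y μ' := fun μ μ' => crossover_Y v μ μ'
  -- strictness unpacked in `X, Y` terms: a visible `μ'` beats every other unequal-moment point
  have hvis : ∀ μ' ∈ S, ∃ c : ℝ, 0 < c ∧ ∀ ν, ν ≠ μ' → Gc ν ≠ 0 → X μ' + c * Y μ' < X ν + c * Y ν := by
    intro μ' hμ'
    obtain ⟨c, hc, hmin⟩ := (hS μ' hμ').2
    refine ⟨c, hc, fun ν hν hG => ?_⟩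
    have h := hmin ν hν ((hGc_ne ν).1 hG)
    simpa only [pencilWeight_split] using h
  -- (1) crossovers with smaller `X` are killed
  have hkill : ∀ μ ∈ S, ∀ μ' ∈ S, X μ < X μ' → Gc (cross μ μ') = 0 := by
    intro μ _ μ' hμ' hlt
    by_contra hne
    obtain ⟨c, hc, hmin⟩ := hvis μ' hμ'
    have hne' : cross μ μ' ≠ μ' := by
      intro h
      have := hcrossX μ μ'
      rw [h] at this
      linarith
    have h := hmin (cross μ μ') hne' hne
    rw [hcrossX, hcrossY] at h
    linarith
  -- (2) `X` is injective on `S`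
  have hinj : Set.InjOn X ↑S := by
    intro μ hμ μ' hμ' hXeq
    by_contra hne
    have hGμ : Gc μ ≠ 0 := (hGc_ne μ).2 (hS μ hμ).1
    have hGμ' : Gc μ' ≠ 0 := (hGc_ne μ').2 (hS μ' hμ').1
    rcases le_total (Y μ) (Y μ') with hle | hle
    · obtain ⟨c, hc, hmin⟩ := hvis μ' hμ'
      have h := hmin μ hne hGμ
      nlinarith
    · obtain ⟨c, hc, hmin⟩ := hvis μ hμ
      have h := hmin μ' (Ne.symm hne) hGμ'
      nlinarith
  -- (3) enumerate `S` by increasing `X`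
  set t := S.card with ht
  have hTcard : (S.image X).card = t := Finset.card_image_of_injOn hinj
  let e : Fin t ↪o ℝ := (S.image X).orderEmbOfFin hTcard
  have he : ∀ a : Fin t, ∃ μ ∈ S, X μ = e a := fun a => by
    simpa only [Finset.mem_image] using (S.image X).orderEmbOfFin_mem hTcard a
  choose μ hμS hμX using he
  have hμlt : ∀ a b : Fin t, a < b → X (μ a) < X (μ b) := fun a b hab => by
    rw [hμX, hμX]; exact e.strictMono hab
  -- (4) the crossover matrix factors through `Fin (m + m)` and is triangular with nonzero diagonal
  let P : Matrix (Fin t) (Fin (m + m)) ℂ := fun a j =>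
    Fin.addCases (motive := fun _ => ℂ)
      (fun j => ∏ i, (if v i = 0 then A j i ^ μ a i else 1))
      (fun j => -∏ i, (if v i = 0 then B j i ^ μ a i else 1)) j
  let Q : Matrix (Fin (m + m)) (Fin t) ℂ := fun j b =>
    Fin.addCases (motive := fun _ => ℂ)
      (fun j => ∏ i, (if v i = 0 then (1 : ℂ) else A j i ^ μ b i))
      (fun j => ∏ i, (if v i = 0 then (1 : ℂ) else B j i ^ μ b i)) j
  have hPQ : ∀ a b, (P * Q) a b = Gc (cross (μ a) (μ b)) := fun a b => by
    simp only [Matrix.mul_apply, P, Q]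
    exact unequalMoment_crossover_eq A B v (μ a) (μ b)
  have hle : t ≤ m + m := by
    refine card_le_of_triangular_factor P Q (fun a => ?_) (fun a b hab => ?_)
    · -- diagonal: `G(μ^a) ≠ 0`
      rw [hPQ]
      have : cross (μ a) (μ a) = μ a := crossover_self v (μ a)
      rw [this]
      exact (hGc_ne _).2 (hS _ (hμS a)).1
    · -- above the diagonal: the crossover is killed by `μ^b`
      rw [hPQ]
      exact hkill (μ a) (hμS a) (μ b) (hμS b) (hμlt a b hab)
  omega

/-- **Corollary (memo's verbatim shape): `≤ 2m` on every coordinate-split pencil plane.**  If the strictly positive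
gradings `θ₁, θ₂ : Fin s → ℝ` are `θ₁ = α·u + β·v`, `θ₂ = γ·u + δ·v` with `α, β, γ, δ > 0` for a disjointly supported
pair `u, v` (`u_i = 0 ∨ v_i = 0`), then every finite set of `(θ₁ + cθ₂)`-pencil-visible unequal moments of two
`m`-point configurations in `ℂ^s` has at most `2m` elements: `θ₁ + cθ₂ = (α + cγ)·(u + c'v)` with
`c' = (β + cδ)/(α + cγ) > 0`, so `(θ₁,θ₂)`-visible points are `(u,v)`-visible.  Covers all pencils on two monomials and
the radix pencils under which a box projects injectively onto a planar grid. [folklore] -/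
theorem liftedPencilCount_splitPlane {m s : ℕ} (A B : Fin m → Fin s → ℂ) (θ₁ θ₂ u v : Fin s → ℝ)
    (hsep : ∀ i, u i = 0 ∨ v i = 0) (α β γ δ : ℝ) (hα : 0 < α) (hβ : 0 < β) (hγ : 0 < γ) (hδ : 0 < δ)
    (h₁ : ∀ i, θ₁ i = α * u i + β * v i) (h₂ : ∀ i, θ₂ i = γ * u i + δ * v i) (S : Finset (Fin s → ℕ))
    (hS : ∀ μ ∈ S, (∑ j, ∏ i, A j i ^ μ i) ≠ (∑ j, ∏ i, B j i ^ μ i) ∧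
      ∃ c : ℝ, 0 < c ∧ ∀ ν : Fin s → ℕ, ν ≠ μ →
        (∑ j, ∏ i, A j i ^ ν i) ≠ (∑ j, ∏ i, B j i ^ ν i) →
          ∑ i, (θ₁ i + c * θ₂ i) * (μ i : ℝ) < ∑ i, (θ₁ i + c * θ₂ i) * (ν i : ℝ)) :
    S.card ≤ 2 * m := by
  refine liftedPencilCount_separatedPencil A B u v hsep S fun μ hμ => ⟨(hS μ hμ).1, ?_⟩
  obtain ⟨c, hc, hmin⟩ := (hS μ hμ).2
  have hαγ : 0 < α + c * γ := by positivity
  refine ⟨(β + c * δ) / (α + c * γ), by positivity, fun ν hν hG => ?_⟩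
  have h := hmin ν hν hG
  -- `θ₁ + cθ₂ = (α + cγ)·(u + c'·v)` coordinatewise
  have hcoef : ∀ i, θ₁ i + c * θ₂ i = (α + c * γ) * (u i + (β + c * δ) / (α + c * γ) * v i) := by
    intro i
    rw [h₁ i, h₂ i]
    field_simp
    ring
  simp only [hcoef, mul_assoc, ← Finset.mul_sum] at h
  exact lt_of_mul_lt_mul_left h hαγ.le

end Summit.ValiantsHypothesis.ValiantsHypothesis.Theorems.NewtonUnitEquations.TwoProducts.FormalLogLinearisation

end
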